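import Mathlib.MeasureTheory.Integral.IntervalIntegral.FundThmCalculus
import Mathlib.Analysis.SpecialFunctions.Sqrt
import Literature.Analysis.FunctionSpaces.TorusClassicalNSUniqueness
import Literature.Analysis.FunctionSpaces.TorusLerayHelmholtz
import Literature.Analysis.FunctionSpaces.TorusDiffMonomialBounds
import Literature.Analysis.FluidPDE.PassiveScalarClassicalEnergy
import Literature.Analysis.FluidPDE.PassiveVector
import HarnessLib

/-!
# `L²`-stability of classical passive scalars under a perturbation of the drift — the `κ`-UNIFORM (gradient) form

For two classical (jointly smooth) solutions of the advection–diffusion equation on `S × T^d` with the SAME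
diffusivity `κ ≥ 0` and divergence-free drifts `u`, `v`,
`∂ₜθ + u·∇θ = κΔθ`, `∂ₜζ + v·∇ζ = κΔζ` (`Torus.IsClassicalScalarTransportOn S κ u θ`, `… S κ v ζ`),
the difference `η = ζ − θ` solves `∂ₜη + v·∇η − κΔη = −(v − u)·∇θ`, so multiplying by `η` and integrating over the
torus (the transport term vanishes by incompressibility, the Laplacian is dissipative) gives the energy inequality
`d/dt ‖η‖² ≤ 2‖η‖_{L²} ‖v − u‖_{L²} ‖∇θ‖_{L^∞}`, whence `‖η(T)‖_{L²} ≤ ‖η(0)‖_{L²} + ∫₀ᵀ ‖(v − u)(t)‖_{L²} G(t) dt`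
for any bound `‖∇θ(t, ·)‖ ≤ G(t)`.  With equal data and the `L²` decay of each solution this yields the form used by the
cell `ad-ideate` (seat ad-p2, K3′ line v2, `ScalarVelocityStability`):
`|‖θ(T)‖² − ‖ζ(T)‖²| ≤ 2‖θ(0)‖ ∫₀ᵀ ‖u − v‖_{L²} G`.
This is the scalar twin of the velocity comparison lemma of Bruè–De Lellis (CMP 2023, §9 Lemma 7: subtract the
equations, multiply by the difference, integrate by parts) and of Evans' energy estimates for second-order parabolic
equations (§7.1.2 (b), Thm. 2).  It complements the tree's `PassiveScalarDriftStability` (Johansson–Sorella 2024,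
Lemma 2.2: `‖w(t)‖² + κ∫‖∇w‖² ≤ (‖θ_in‖²_∞/κ) ∫∫|u₁ − u₂|²`, which puts the derivative on `w` and pays `1/κ`): here the
derivative stays on the reference solution `θ` and the estimate is UNIFORM in `κ ≥ 0` — the form a vanishing-diffusivity
argument needs (the cost `∫‖u − v‖_{L²}‖∇θ‖_∞` of the cell's closure budget).  Ingredients: the tree's differentiation under the torus integral within a convex time
set (`Torus.IsSmoothSpaceTimeOn.hasDerivWithinAt_integral`), the two integrations by parts of
`PassiveScalarClassicalEnergy`, Hölder on the torus, and an elementary comparison lemma for `φ' ≤ 2√φ·g`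
(`sqrt_le_sqrt_add_integral_of_hasDerivWithinAt`, via `√(φ + ε²)` and the fundamental theorem of calculus); the
torus Cauchy–Schwarz / `L²` triangle inequalities are the tree's (`TorusDiffMonomialBounds`).  No facts, no axioms.

## References
* E. Bruè, C. De Lellis, *Anomalous dissipation for the forced 3D Navier–Stokes equations*, Comm. Math. Phys. 400
  (2023), §9 Lemma 7 (= arXiv:2207.06301 App., (e:Gronwall)). [BrueDeLellisCMP2023]
* L. C. Evans, *Partial Differential Equations*, 2nd ed. (2010), §7.1.2 (b) Thm. 2. [Evans2010]
* T. D. Drivas, T. M. Elgindi, G. Iyer, I.-J. Jeong, ARMA 243 (2022), (1.2)–(1.3). [DEIJ2022]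
-/

open MeasureTheory Set Filter
open _root_.Topology
open scoped InnerProductSpace ENNReal NNReal

noncomputable section

namespace Literature.Analysis.FluidPDE

namespace Torus

variable {d : Type*} [Fintype d] [DecidableEq d]

/-! ## An elementary comparison lemma: `φ' ≤ 2√φ·g` -/

omit [Fintype d] [DecidableEq d] in
/-- **Comparison lemma.** If `φ ≥ 0` on `[0, T]`, `φ` has the continuous one-sided derivative `D` within `[0, T]` and
`D ≤ 2√φ·g` with `g ≥ 0` integrable, then `√(φ(T)) ≤ √(φ(0)) + ∫₀ᵀ g` (apply the fundamental theorem of calculus to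
`√(φ + ε²)`, whose derivative is `≤ g`, and let `ε → 0`; the Grönwall-type step of Bruè–De Lellis' Lemma 7).
[cite: BrueDeLellisCMP2023, §9 Lemma 7 ("from (e:Gronwall) one concludes immediately … u^ν → u in C([0,T]; L²)")] -/
theorem sqrt_le_sqrt_add_integral_of_hasDerivWithinAt {φ D g : ℝ → ℝ} {T : ℝ} (hT : 0 ≤ T)
    (hφ : ∀ t ∈ Icc (0 : ℝ) T, HasDerivWithinAt φ (D t) (Icc (0 : ℝ) T) t)
    (hD : ContinuousOn D (Icc (0 : ℝ) T)) (hpos : ∀ t ∈ Icc (0 : ℝ) T, 0 ≤ φ t)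
    (hle : ∀ t ∈ Icc (0 : ℝ) T, D t ≤ 2 * Real.sqrt (φ t) * g t) (hg0 : ∀ t ∈ Icc (0 : ℝ) T, 0 ≤ g t)
    (hg : IntervalIntegrable g volume 0 T) :
    Real.sqrt (φ T) ≤ Real.sqrt (φ 0) + ∫ t in (0 : ℝ)..T, g t := by
  rcases eq_or_lt_of_le hT with rfl | hT'
  · simp
  refine le_of_forall_pos_le_add fun ε hε => ?_
  have hpos' : ∀ t ∈ Icc (0 : ℝ) T, 0 < φ t + ε ^ 2 := fun t ht =>
    add_pos_of_nonneg_of_pos (hpos t ht) (pow_pos hε 2)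
  set ψ : ℝ → ℝ := fun t => Real.sqrt (φ t + ε ^ 2) with hψ_def
  set ψ' : ℝ → ℝ := fun t => D t / (2 * Real.sqrt (φ t + ε ^ 2)) with hψ'_def
  have hψ : ∀ t ∈ Icc (0 : ℝ) T, HasDerivWithinAt ψ (ψ' t) (Icc (0 : ℝ) T) t := fun t ht =>
    ((hφ t ht).add_const (ε ^ 2)).sqrt (hpos' t ht).ne'
  have hφc : ContinuousOn φ (Icc (0 : ℝ) T) := fun t ht => (hφ t ht).continuousWithinAt
  have hψc : ContinuousOn ψ (Icc (0 : ℝ) T) := fun t ht => (hψ t ht).continuousWithinAt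
  have hψ'c : ContinuousOn ψ' (Icc (0 : ℝ) T) := by
    refine hD.div (continuousOn_const.mul (hφc.add continuousOn_const).sqrt) fun t ht => ?_
    exact mul_ne_zero two_ne_zero (Real.sqrt_pos.2 (hpos' t ht)).ne'
  have hFTC : ∫ t in (0 : ℝ)..T, ψ' t = ψ T - ψ 0 :=
    intervalIntegral.integral_eq_sub_of_hasDerivAt_of_le hT hψc
      (fun t ht => (hψ t (Ioo_subset_Icc_self ht)).hasDerivAt (Icc_mem_nhds ht.1 ht.2))
      (hψ'c.intervalIntegrable_of_Icc hT)
  have hle' : ∀ t ∈ Icc (0 : ℝ) T, ψ' t ≤ g t := by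
    intro t ht
    have hs : Real.sqrt (φ t) ≤ Real.sqrt (φ t + ε ^ 2) :=
      Real.sqrt_le_sqrt (le_add_of_nonneg_right (sq_nonneg ε))
    have hspos : 0 < Real.sqrt (φ t + ε ^ 2) := Real.sqrt_pos.2 (hpos' t ht)
    have hgt := hg0 t ht
    calc ψ' t = D t / (2 * Real.sqrt (φ t + ε ^ 2)) := rfl
      _ ≤ (2 * Real.sqrt (φ t + ε ^ 2) * g t) / (2 * Real.sqrt (φ t + ε ^ 2)) := by
          apply div_le_div_of_nonneg_right _ (by positivity)
          exact (hle t ht).trans (by nlinarith)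
      _ = g t := by field_simp
  have hmono := intervalIntegral.integral_mono_on hT (hψ'c.intervalIntegrable_of_Icc hT) hg hle'
  have hψ0 : ψ 0 ≤ Real.sqrt (φ 0) + ε := by
    have h0 : 0 ≤ φ 0 := hpos 0 (left_mem_Icc.2 hT)
    have h1 : φ 0 + ε ^ 2 ≤ (Real.sqrt (φ 0) + ε) ^ 2 := by
      nlinarith [Real.sq_sqrt h0, Real.sqrt_nonneg (φ 0)]
    calc ψ 0 = Real.sqrt (φ 0 + ε ^ 2) := rfl
      _ ≤ Real.sqrt ((Real.sqrt (φ 0) + ε) ^ 2) := Real.sqrt_le_sqrt h1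
      _ = Real.sqrt (φ 0) + ε := Real.sqrt_sq (by positivity)
  have hψT : Real.sqrt (φ T) ≤ ψ T := Real.sqrt_le_sqrt (le_add_of_nonneg_right (sq_nonneg ε))
  linarith

namespace IsClassicalScalarTransportOn

variable {S : Set ℝ} {κ : ℝ} {u v : ℝ → UnitAddTorus d → EuclideanSpace ℝ d}
  {θ ζ : ℝ → UnitAddTorus d → ℝ}

/-- **Energy identity for the difference of two classical passive scalars with the same diffusivity.** For
`∂ₜθ + u·∇θ = κΔθ` and `∂ₜζ + v·∇ζ = κΔζ` on a convex time set `S`, the difference `η = ζ − θ` satisfies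
`d/dt ‖η(t)‖²_{L²} = −2κ‖∇η(t)‖²_{L²} − 2∫ η ⟪v − u, ∇θ⟫` within `S` (subtract, multiply by `η`, integrate:
`∫ η ⟪v, ∇η⟫ = 0` by incompressibility, `∫ η Δη = −‖∇η‖²`). [cite: BrueDeLellisCMP2023, §9 Lemma 7 (proof: "subtract the two equations … multiply by u^ν − u, integrate in space")] -/
theorem hasDerivWithinAt_scalarL2Sq_sub_of_drifts (hθ : IsClassicalScalarTransportOn S κ u θ)
    (hζ : IsClassicalScalarTransportOn S κ v ζ) (hS : Convex ℝ S) {t : ℝ} (ht : t ∈ S) :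
    HasDerivWithinAt (fun s => scalarL2Sq (fun x => ζ s x - θ s x))
      (-(2 * κ) * scalarGradNormSq (fun x => ζ t x - θ t x) -
        2 * ∫ x, (ζ t x - θ t x) * ⟪v t x - u t x, FunctionSpaces.Torus.gradient (θ t) x⟫_ℝ) S t := by
  by_cases hacc : AccPt t (𝓟 S)
  swap
  · exact HasFDerivWithinAt.of_not_accPt hacc
  have hU : UniqueDiffOn ℝ S :=
    uniqueDiffOn_convex hS (FunctionSpaces.Torus.interior_nonempty_of_convex_of_accPt hS ht hacc)
  set η : ℝ → UnitAddTorus d → ℝ := fun s x => ζ s x - θ s x with hη_def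
  have hηs : FunctionSpaces.Torus.IsSmoothSpaceTimeOn S η := hζ.smooth_scalar.sub hθ.smooth_scalar
  have hηt : FunctionSpaces.Torus.IsSmooth (η t) := hηs.isSmooth_slice ht
  have hθt : FunctionSpaces.Torus.IsSmooth (θ t) := hθ.smooth_scalar.isSmooth_slice ht
  have hζt : FunctionSpaces.Torus.IsSmooth (ζ t) := hζ.smooth_scalar.isSmooth_slice ht
  have hut : FunctionSpaces.Torus.IsSmooth (u t) := hθ.smooth_velocity.isSmooth_slice ht
  have hvt : FunctionSpaces.Torus.IsSmooth (v t) := hζ.smooth_velocity.isSmooth_slice ht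
  -- differentiate `∫ η²` under the integral sign
  have hφ : FunctionSpaces.Torus.IsSmoothSpaceTimeOn S (fun s x => η s x * η s x) := hηs.mul hηs
  have hE := hφ.hasDerivWithinAt_integral hS ht
  have hdη : ∀ x, FunctionSpaces.Torus.timeDerivWithin S η t x =
      FunctionSpaces.Torus.timeDerivWithin S ζ t x - FunctionSpaces.Torus.timeDerivWithin S θ t x := by
    intro x
    have h2 : HasDerivWithinAt (fun τ => η τ x)
        (FunctionSpaces.Torus.timeDerivWithin S ζ t x - FunctionSpaces.Torus.timeDerivWithin S θ t x) S t :=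
      (hζ.smooth_scalar.hasDerivWithinAt_slice ht x).sub (hθ.smooth_scalar.hasDerivWithinAt_slice ht x)
    rw [FunctionSpaces.Torus.timeDerivWithin, h2.derivWithin (hU t ht)]
  have htd : ∀ x, FunctionSpaces.Torus.timeDerivWithin S (fun s x => η s x * η s x) t x =
      2 * (η t x * FunctionSpaces.Torus.timeDerivWithin S η t x) := by
    intro x
    have h2 : HasDerivWithinAt (fun τ => η τ x * η τ x)
        (FunctionSpaces.Torus.timeDerivWithin S η t x * η t x +
          η t x * FunctionSpaces.Torus.timeDerivWithin S η t x) S t :=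
      (hηs.hasDerivWithinAt_slice ht x).mul (hηs.hasDerivWithinAt_slice ht x)
    rw [FunctionSpaces.Torus.timeDerivWithin, h2.derivWithin (hU t ht)]
    ring
  have hfun : (fun s => scalarL2Sq (fun x => ζ s x - θ s x)) = fun s => ∫ x, η s x * η s x := by
    funext s
    simp only [scalarL2Sq, sq, hη_def]
  rw [hfun]
  refine hE.congr_deriv ?_
  -- pointwise: ∂ₜη = κΔη − ⟪v, ∇η⟫ − ⟪v − u, ∇θ⟫
  have hηeq : η t = ζ t - θ t := rfl
  have hlap : ∀ x, FunctionSpaces.Torus.laplacian (η t) x =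
      FunctionSpaces.Torus.laplacian (ζ t) x - FunctionSpaces.Torus.laplacian (θ t) x := by
    intro x
    rw [hηeq, FunctionSpaces.Torus.laplacian_sub hζt hθt, Pi.sub_apply]
  have hgrad : ∀ x, FunctionSpaces.Torus.gradient (η t) x =
      FunctionSpaces.Torus.gradient (ζ t) x - FunctionSpaces.Torus.gradient (θ t) x := by
    intro x
    rw [hηeq]
    exact FunctionSpaces.Torus.gradient_sub (hζt.isContDiff (by simp)) (hθt.isContDiff (by simp)) x
  have hpt : (fun x => FunctionSpaces.Torus.timeDerivWithin S (fun s x => η s x * η s x) t x) =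
      fun x => 2 * κ * (η t x * FunctionSpaces.Torus.laplacian (η t) x) -
        2 * (η t x * ⟪v t x, FunctionSpaces.Torus.gradient (η t) x⟫_ℝ) -
        2 * (η t x * ⟪v t x - u t x, FunctionSpaces.Torus.gradient (θ t) x⟫_ℝ) := by
    funext x
    rw [htd x, hdη x, hlap x, hgrad x]
    have h1 := hθ.transport t ht x
    have h2 := hζ.transport t ht x
    have e1 : FunctionSpaces.Torus.timeDerivWithin S θ t x =
        κ * FunctionSpaces.Torus.laplacian (θ t) x - ⟪u t x, FunctionSpaces.Torus.gradient (θ t) x⟫_ℝ := by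
      linarith
    have e2 : FunctionSpaces.Torus.timeDerivWithin S ζ t x =
        κ * FunctionSpaces.Torus.laplacian (ζ t) x - ⟪v t x, FunctionSpaces.Torus.gradient (ζ t) x⟫_ℝ := by
      linarith
    rw [e1, e2, inner_sub_right, inner_sub_left]
    ring
  have i1 : Integrable (fun x => η t x * FunctionSpaces.Torus.laplacian (η t) x) volume :=
    (hηt.smul' hηt.laplacian).integrable
  have i2 : Integrable (fun x => η t x * ⟪v t x, FunctionSpaces.Torus.gradient (η t) x⟫_ℝ) volume :=
    (hηt.smul' (hvt.inner hηt.gradient)).integrable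
  have i3 : Integrable (fun x => η t x * ⟪v t x - u t x, FunctionSpaces.Torus.gradient (θ t) x⟫_ℝ) volume :=
    (hηt.smul' ((hvt.sub hut).inner hθt.gradient)).integrable
  have j1 : Integrable (fun x => 2 * κ * (η t x * FunctionSpaces.Torus.laplacian (η t) x)) volume :=
    i1.const_mul _
  have j2 : Integrable (fun x => 2 * (η t x * ⟪v t x, FunctionSpaces.Torus.gradient (η t) x⟫_ℝ)) volume :=
    i2.const_mul _
  have j3 : Integrable
      (fun x => 2 * (η t x * ⟪v t x - u t x, FunctionSpaces.Torus.gradient (θ t) x⟫_ℝ)) volume :=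
    i3.const_mul _
  have j12 : Integrable (fun x => 2 * κ * (η t x * FunctionSpaces.Torus.laplacian (η t) x) -
      2 * (η t x * ⟪v t x, FunctionSpaces.Torus.gradient (η t) x⟫_ℝ)) volume := j1.sub j2
  rw [hpt, integral_sub j12 j3, integral_sub j1 j2, integral_const_mul, integral_const_mul,
    integral_const_mul, integral_mul_laplacian_self_eq_neg_scalarGradNormSq hηt,
    integral_mul_inner_gradient_self_eq_zero hvt (hζ.divFree t ht) hηt]
  simp only [hη_def]
  ring

/-- **`L²`-stability of classical passive scalars under a drift perturbation.** For two classical solutions with the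
same diffusivity `κ ≥ 0` on `S ⊇ [0, T]` and any bound `‖∇θ(t,·)‖ ≤ G(t)` on `[0, T]` with
`t ↦ ‖(u − v)(t)‖_{L²} G(t)` integrable:
`‖(ζ − θ)(T)‖_{L²} ≤ ‖(ζ − θ)(0)‖_{L²} + ∫₀ᵀ ‖(u − v)(t)‖_{L²} G(t) dt`
(energy identity for the difference, `−2κ‖∇η‖² ≤ 0`, Cauchy–Schwarz, and the comparison lemma).
[cite: BrueDeLellisCMP2023, §9 Lemma 7 (e:Gronwall) (velocity version; scalar twin)]
[cite: Evans2010, §7.1.2 (b) Thm. 2 (energy estimates)] -/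
theorem sqrt_scalarL2Sq_sub_le_of_drifts (hθ : IsClassicalScalarTransportOn S κ u θ)
    (hζ : IsClassicalScalarTransportOn S κ v ζ) (hκ : 0 ≤ κ) {T : ℝ} (hT : 0 ≤ T)
    (hST : Icc 0 T ⊆ S) {G : ℝ → ℝ}
    (hG : ∀ t ∈ Icc 0 T, ∀ x, ‖FunctionSpaces.Torus.gradient (θ t) x‖ ≤ G t)
    (hint : IntervalIntegrable (fun t => Real.sqrt (vectorL2Sq (u t - v t)) * G t) volume 0 T) :
    Real.sqrt (scalarL2Sq (fun x => ζ T x - θ T x)) ≤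
      Real.sqrt (scalarL2Sq (fun x => ζ 0 x - θ 0 x)) +
        ∫ t in (0 : ℝ)..T, Real.sqrt (vectorL2Sq (u t - v t)) * G t := by
  rcases eq_or_lt_of_le hT with rfl | hT'
  · simp
  -- restrict to `[0, T]`
  have hθ' := hθ.restrict_Icc hT' hST
  have hζ' := hζ.restrict_Icc hT' hST
  have hconv : Convex ℝ (Icc (0 : ℝ) T) := convex_Icc 0 T
  have hU : UniqueDiffOn ℝ (Icc (0 : ℝ) T) := uniqueDiffOn_Icc hT'
  set η : ℝ → UnitAddTorus d → ℝ := fun s x => ζ s x - θ s x with hη_def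
  have hηs : FunctionSpaces.Torus.IsSmoothSpaceTimeOn (Icc (0 : ℝ) T) η :=
    hζ'.smooth_scalar.sub hθ'.smooth_scalar
  set φ : ℝ → ℝ := fun s => scalarL2Sq (fun x => ζ s x - θ s x) with hφ_def
  set D : ℝ → ℝ := fun t => -(2 * κ) * scalarGradNormSq (fun x => ζ t x - θ t x) -
    2 * ∫ x, (ζ t x - θ t x) * ⟪v t x - u t x, FunctionSpaces.Torus.gradient (θ t) x⟫_ℝ with hD_def
  set g : ℝ → ℝ := fun t => Real.sqrt (vectorL2Sq (u t - v t)) * G t with hg_def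
  have hderiv : ∀ t ∈ Icc (0 : ℝ) T, HasDerivWithinAt φ (D t) (Icc (0 : ℝ) T) t := fun t ht =>
    hasDerivWithinAt_scalarL2Sq_sub_of_drifts hθ' hζ' hconv ht
  -- continuity of `D` on `[0, T]`
  have hDc : ContinuousOn D (Icc (0 : ℝ) T) := by
    have hg1 := hηs.gradient hU
    have hA : ContinuousOn (fun t => scalarGradNormSq (fun x => ζ t x - θ t x)) (Icc (0 : ℝ) T) := by
      have hc := (hg1.inner hg1).continuousOn_integral hconv
      refine hc.congr fun t _ => ?_
      simp only [scalarGradNormSq, real_inner_self_eq_norm_sq, hη_def]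
    have hB : ContinuousOn
        (fun t => ∫ x, (ζ t x - θ t x) * ⟪v t x - u t x, FunctionSpaces.Torus.gradient (θ t) x⟫_ℝ)
        (Icc (0 : ℝ) T) :=
      (hηs.mul ((hζ'.smooth_velocity.sub hθ'.smooth_velocity).inner
        (hθ'.smooth_scalar.gradient hU))).continuousOn_integral hconv
    exact ((continuousOn_const.mul hA).sub (continuousOn_const.mul hB))
  have hpos : ∀ t ∈ Icc (0 : ℝ) T, 0 ≤ φ t := fun t _ => scalarL2Sq_nonneg _
  have hg0 : ∀ t ∈ Icc (0 : ℝ) T, 0 ≤ g t := fun t ht =>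
    mul_nonneg (Real.sqrt_nonneg _) ((norm_nonneg _).trans (hG t ht 0))
  -- the differential inequality `D ≤ 2 √φ g`
  have hle : ∀ t ∈ Icc (0 : ℝ) T, D t ≤ 2 * Real.sqrt (φ t) * g t := by
    intro t ht
    have hθt : FunctionSpaces.Torus.IsSmooth (θ t) := hθ'.smooth_scalar.isSmooth_slice ht
    have hηt : FunctionSpaces.Torus.IsSmooth (η t) := hηs.isSmooth_slice ht
    have hut : FunctionSpaces.Torus.IsSmooth (u t) := hθ'.smooth_velocity.isSmooth_slice ht
    have hvt : FunctionSpaces.Torus.IsSmooth (v t) := hζ'.smooth_velocity.isSmooth_slice ht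
    have hwc : Continuous (fun x => v t x - u t x) := hvt.continuous.sub hut.continuous
    have hGt : 0 ≤ G t := (norm_nonneg _).trans (hG t ht 0)
    -- −∫ η ⟪v−u, ∇θ⟫ ≤ G ∫ |η| ‖v − u‖
    have i_src : Integrable
        (fun x => (ζ t x - θ t x) * ⟪v t x - u t x, FunctionSpaces.Torus.gradient (θ t) x⟫_ℝ) volume :=
      (hηt.smul' ((hvt.sub hut).inner hθt.gradient)).integrable
    have i_bd : Integrable (fun x => |η t x| * ‖v t x - u t x‖ * G t) volume :=
      ((hηt.continuous.abs.mul hwc.norm).mul continuous_const).integrable_unitAddTorus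
    have h1 : -(∫ x, (ζ t x - θ t x) * ⟪v t x - u t x, FunctionSpaces.Torus.gradient (θ t) x⟫_ℝ) ≤
        ∫ x, |η t x| * ‖v t x - u t x‖ * G t := by
      rw [← integral_neg]
      refine integral_mono i_src.neg i_bd fun x => ?_
      have hin : |⟪v t x - u t x, FunctionSpaces.Torus.gradient (θ t) x⟫_ℝ| ≤ ‖v t x - u t x‖ * G t :=
        (abs_real_inner_le_norm _ _).trans (mul_le_mul_of_nonneg_left (hG t ht x) (norm_nonneg _))
      have : -((ζ t x - θ t x) * ⟪v t x - u t x, FunctionSpaces.Torus.gradient (θ t) x⟫_ℝ) ≤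
          |η t x| * (‖v t x - u t x‖ * G t) := by
        calc -((ζ t x - θ t x) * ⟪v t x - u t x, FunctionSpaces.Torus.gradient (θ t) x⟫_ℝ)
            ≤ |(ζ t x - θ t x) * ⟪v t x - u t x, FunctionSpaces.Torus.gradient (θ t) x⟫_ℝ| := neg_le_abs _
          _ = |η t x| * |⟪v t x - u t x, FunctionSpaces.Torus.gradient (θ t) x⟫_ℝ| := by rw [abs_mul]
          _ ≤ |η t x| * (‖v t x - u t x‖ * G t) := mul_le_mul_of_nonneg_left hin (abs_nonneg _)
      simpa [mul_assoc] using this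
    have h2 : ∫ x, |η t x| * ‖v t x - u t x‖ * G t ≤
        Real.sqrt (φ t) * Real.sqrt (vectorL2Sq (u t - v t)) * G t := by
      rw [integral_mul_const]
      refine mul_le_mul_of_nonneg_right ?_ hGt
      have hcs := FunctionSpaces.Torus.integral_mul_le_sqrt_mul_sqrt hηt.continuous.abs hwc.norm
      have eφ : (∫ x, |η t x| ^ 2) = φ t := by simp only [hφ_def, scalarL2Sq, hη_def, sq_abs]
      have ev : (∫ x, ‖v t x - u t x‖ ^ 2) = vectorL2Sq (u t - v t) := by
        simp only [vectorL2Sq, Pi.sub_apply, norm_sub_rev]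
      rw [eφ, ev] at hcs
      exact hcs
    have h3 : -(2 * κ) * scalarGradNormSq (fun x => ζ t x - θ t x) ≤ 0 := by
      have := scalarGradNormSq_nonneg (fun x => ζ t x - θ t x)
      nlinarith
    calc D t ≤ 0 + 2 * (Real.sqrt (φ t) * Real.sqrt (vectorL2Sq (u t - v t)) * G t) := by
          simp only [hD_def]
          linarith
      _ = 2 * Real.sqrt (φ t) * g t := by simp only [hg_def]; ring
  have hmain := sqrt_le_sqrt_add_integral_of_hasDerivWithinAt hT hderiv hDc hpos hle hg0 hint
  simpa [hφ_def] using hmain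

/-- **The cell's form** (ad-ideate-p2, K3′ line v2, `ScalarVelocityStability`, any dimension): two classical
solutions with the same diffusivity `κ ≥ 0` and the SAME datum on a convex `S ⊇ [0, T]`; then
`|‖θ(T)‖²_{L²} − ‖ζ(T)‖²_{L²}| ≤ 2‖θ(0)‖_{L²} ∫₀ᵀ ‖(u − v)(t)‖_{L²} G(t) dt` for any gradient bound
`‖∇θ(t,·)‖ ≤ G(t)` (`|a² − b²| ≤ ‖θ(T) − ζ(T)‖ (‖θ(T)‖ + ‖ζ(T)‖)`, the `L²` norms are non-increasing, and
`sqrt_scalarL2Sq_sub_le_of_drifts`). [cite: BrueDeLellisCMP2023, §9 Lemma 7 (scalar twin of the velocity comparison)]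
[cite: DEIJ2022, (1.3) (the L² norm of each solution is non-increasing)] -/
theorem scalarVelocityStability :
    ∀ (S : Set ℝ) (κ T : ℝ) (u v : ℝ → UnitAddTorus d → EuclideanSpace ℝ d)
      (θ ζ : ℝ → UnitAddTorus d → ℝ) (G : ℝ → ℝ),
      0 ≤ κ → 0 ≤ T → Convex ℝ S → Icc 0 T ⊆ S →
      IsClassicalScalarTransportOn S κ u θ → IsClassicalScalarTransportOn S κ v ζ →
      θ 0 = ζ 0 →
      (∀ t ∈ Icc 0 T, ∀ x, ‖FunctionSpaces.Torus.gradient (θ t) x‖ ≤ G t) →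
      IntervalIntegrable (fun t => Real.sqrt (vectorL2Sq (u t - v t)) * G t) volume 0 T →
      |scalarL2Sq (θ T) - scalarL2Sq (ζ T)| ≤
        2 * Real.sqrt (scalarL2Sq (θ 0)) *
          ∫ t in (0 : ℝ)..T, Real.sqrt (vectorL2Sq (u t - v t)) * G t := by
  intro S κ T u v θ ζ G hκ hT _ hST hθ hζ h0 hG hint
  have hE := sqrt_scalarL2Sq_sub_le_of_drifts hθ hζ hκ hT hST hG hint
  have hη0 : scalarL2Sq (fun x => ζ 0 x - θ 0 x) = 0 := by
    simp [scalarL2Sq, h0]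
  rw [hη0, Real.sqrt_zero, zero_add] at hE
  set I := ∫ t in (0 : ℝ)..T, Real.sqrt (vectorL2Sq (u t - v t)) * G t with hI
  have hTT : T ∈ Icc (0 : ℝ) T := right_mem_Icc.2 hT
  have h00 : (0 : ℝ) ∈ Icc (0 : ℝ) T := left_mem_Icc.2 hT
  have hθT : FunctionSpaces.Torus.IsSmooth (θ T) := hθ.smooth_scalar.isSmooth_slice (hST hTT)
  have hζT : FunctionSpaces.Torus.IsSmooth (ζ T) := hζ.smooth_scalar.isSmooth_slice (hST hTT)
  set A := Real.sqrt (scalarL2Sq (θ T)) with hA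
  set B := Real.sqrt (scalarL2Sq (ζ T)) with hB
  set A₀ := Real.sqrt (scalarL2Sq (θ 0)) with hA₀
  set E := Real.sqrt (scalarL2Sq (fun x => ζ T x - θ T x)) with hEdef
  have hI0 : 0 ≤ I := le_trans (Real.sqrt_nonneg _) hE
  -- `L²` decay of each solution
  have hAle : A ≤ A₀ :=
    Real.sqrt_le_sqrt (hθ.antitoneOn_scalarL2Sq hκ hST h00 hTT hT)
  have hBle : B ≤ A₀ := by
    have := hζ.antitoneOn_scalarL2Sq hκ hST h00 hTT hT
    have e : scalarL2Sq (ζ 0) = scalarL2Sq (θ 0) := by rw [h0]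
    exact Real.sqrt_le_sqrt (this.trans_eq e)
  -- `|a² − b²| ≤ E (A + B)`
  have hcont : Continuous (fun x => ζ T x - θ T x) := hζT.continuous.sub hθT.continuous
  have hsum : Continuous (fun x => θ T x + ζ T x) := hθT.continuous.add hζT.continuous
  have hdiff : scalarL2Sq (θ T) - scalarL2Sq (ζ T) = -∫ x, (ζ T x - θ T x) * (θ T x + ζ T x) := by
    have iθ : Integrable (fun x => θ T x ^ 2) volume := (hθT.continuous.pow 2).integrable_unitAddTorus
    have iζ : Integrable (fun x => ζ T x ^ 2) volume := (hζT.continuous.pow 2).integrable_unitAddTorus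
    simp only [scalarL2Sq]
    rw [← integral_sub iθ iζ, ← integral_neg]
    congr 1; funext x; ring
  have habs : |scalarL2Sq (θ T) - scalarL2Sq (ζ T)| ≤ E * (A + B) := by
    rw [hdiff, abs_neg]
    have h1 : |∫ x, (ζ T x - θ T x) * (θ T x + ζ T x)| ≤ ∫ x, |ζ T x - θ T x| * |θ T x + ζ T x| := by
      refine (abs_integral_le_integral_abs).trans (le_of_eq ?_)
      congr 1; funext x
      rw [abs_mul]
    have h2 := FunctionSpaces.Torus.integral_mul_le_sqrt_mul_sqrt hcont.abs hsum.abs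
    simp only [sq_abs] at h2
    have h3 : Real.sqrt (∫ x, (θ T x + ζ T x) ^ 2) ≤ A + B := by
      have := FunctionSpaces.Torus.sqrt_integral_add_sq_le hθT.continuous hζT.continuous
      simpa [scalarL2Sq, hA, hB] using this
    have hE' : Real.sqrt (∫ x, (ζ T x - θ T x) ^ 2) = E := by simp only [hEdef, scalarL2Sq]
    calc |∫ x, (ζ T x - θ T x) * (θ T x + ζ T x)|
        ≤ Real.sqrt (∫ x, (ζ T x - θ T x) ^ 2) * Real.sqrt (∫ x, (θ T x + ζ T x) ^ 2) := h1.trans h2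
      _ ≤ E * (A + B) := by
          rw [hE']
          exact mul_le_mul_of_nonneg_left h3 (Real.sqrt_nonneg _)
  have hA0' : 0 ≤ A₀ := Real.sqrt_nonneg _
  calc |scalarL2Sq (θ T) - scalarL2Sq (ζ T)| ≤ E * (A + B) := habs
    _ ≤ I * (A₀ + A₀) := mul_le_mul hE (add_le_add hAle hBle)
        (add_nonneg (Real.sqrt_nonneg _) (Real.sqrt_nonneg _)) hI0
    _ = 2 * A₀ * I := by ring

end IsClassicalScalarTransportOn

end Torus

end Literature.Analysis.FluidPDE

end
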